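import Mathlib.InformationTheory.KullbackLeibler.Basic
import Mathlib.Probability.ConditionalProbability
import Literature.Probability.Entropy.EntropyMethodNecessity

/-!
# Entropy bound for tangent states, VIII: additivity of the relative entropy along a conditioning (line `FirstLemma`, crux stmt-AtomisticToContinuum-14135)

Helper file of the registered stub `c9_klDiv_eq_klDiv_cond_add_klDiv_cond` (lead seat c9, Gibbs route of the
uniform entropy bound), namespace `Summit.AtomisticToContinuum.HydrodynamicLimit.Theorems.KiferCompactification`.

In the Gibbs route of the line's entropy bound the blown-up canonical law `G'` is a product reference `ρ`
CONDITIONED on an event `E` (torus hard core and particle number): `G' = ρ(· | E)`. For every probability law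
`P ≪ G'` one then has `KL(P ‖ ρ) = KL(P ‖ G') + KL(G' ‖ ρ)` with `KL(G' ‖ ρ) = −log ρ(E)`, the `Q`-independent
constant of the cell inequality. This file proves the abstract identity for Mathlib's `InformationTheory.klDiv`
and the conditional measure `μ[|E] = (μ E)⁻¹ • μ.restrict E` of `Mathlib.Probability.ConditionalProbability`:

* `c9_klDiv_eq_klDiv_cond_add_klDiv_cond` — for probability measures `P`, `μ`, a measurable `E` and
  `P ≪ μ[|E]`: `klDiv P μ = klDiv P (μ[|E]) + klDiv (μ[|E]) μ` in `ℝ≥0∞` (both sides are `∞` together).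

Proof (chain rule of Radon–Nikodym derivatives). `μ E ≠ 0` since `P ≪ μ[|E]` and `P ≠ 0`
(`measure_ne_zero_of_absolutelyContinuous_cond`); `μ[|E] = μ.withDensity ((μ E)⁻¹ 𝟙_E)`
(`cond_eq_withDensity_indicator`), so `d(μ[|E])/dμ = (μ E)⁻¹ 𝟙_E` `μ`-a.e. (`rnDeriv_cond_ae_eq`); with
`dP/d(μ[|E]) · d(μ[|E])/dμ = dP/dμ` (Mathlib `Measure.rnDeriv_mul_rnDeriv`) and `P(Eᶜ) = 0` this gives
`llr P μ = llr P (μ[|E]) − log μ(E)` `P`-a.e. (`llr_eq_llr_cond_add`). Hence the two log-likelihood ratios are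
`P`-integrable simultaneously (`integrable_llr_iff_integrable_llr_cond`), their integrals differ by `−log μ(E) ≥ 0`
(`integral_llr_eq_integral_llr_cond_sub_log`), and `klDiv (μ[|E]) μ = ofReal (−log μ(E))` (`klDiv_cond_self`, from
`Literature.Probability.Entropy.toReal_klDiv_cond`). The by-products are public; the finite (real) form is
`toReal_klDiv_eq_toReal_klDiv_cond_sub_log`.

Related tree fact: `…Theorems.EntropyBall.klDiv_eq_klDiv_cond_add`
(`AntiMazurCoboundariesCellForecastPressureDecayKBClosureEntropyTools.lean`, crux stmt-13915) is the same identity in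
the form `… + ofReal (−log π(A))` under an explicit `π A ≠ 0`; it lives behind that crux's objects module, so the
Radon–Nikodym bookkeeping (about twenty lines) is redone here on Mathlib-light imports, with the intermediate steps
exposed. References: S. Kullback, *Information Theory and Statistics* (1959), §2.4 (additivity); I. Csiszár,
Ann. Probab. 3 (1975), eq. (2.14). Every statement is elementary and tagged `[folklore]`.
-/

noncomputable section

open MeasureTheory ProbabilityTheory Set Filter Topology InformationTheory
open scoped ENNReal NNReal

namespace Summit.AtomisticToContinuum.HydrodynamicLimit.Theorems.KiferCompactification

variable {Ω : Type*} [MeasurableSpace Ω]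

/-! ## The conditioned measure as a density -/

/-- The conditioned measure is the reference with density `(μ E)⁻¹ 𝟙_E`. [folklore] -/
theorem cond_eq_withDensity_indicator (μ : Measure Ω) {E : Set Ω} (hE : MeasurableSet E) :
    μ[|E] = μ.withDensity (fun x => (μ E)⁻¹ * E.indicator 1 x) := by
  rw [ProbabilityTheory.cond, ← withDensity_indicator_one hE,
    ← withDensity_smul _ (measurable_one.indicator hE)]
  rfl

/-- **Density of the conditioned measure**: `d(μ[|E])/dμ = (μ E)⁻¹ 𝟙_E` `μ`-a.e. [folklore] -/
theorem rnDeriv_cond_ae_eq (μ : Measure Ω) [SigmaFinite μ] {E : Set Ω} (hE : MeasurableSet E) :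
    (μ[|E]).rnDeriv μ =ᵐ[μ] fun x => (μ E)⁻¹ * E.indicator 1 x := by
  rw [cond_eq_withDensity_indicator μ hE]
  exact Measure.rnDeriv_withDensity _ (measurable_const.mul (measurable_one.indicator hE))

/-- A probability measure absolutely continuous with respect to `μ[|E]` forces `μ E ≠ 0` (otherwise `μ[|E] = 0`).
[folklore] -/
theorem measure_ne_zero_of_absolutelyContinuous_cond {P μ : Measure Ω} [IsProbabilityMeasure P] {E : Set Ω}
    (hPE : P ≪ μ[|E]) : μ E ≠ 0 := by
  intro h0
  have h1 : (μ[|E]) univ = 0 := by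
    rw [cond_eq_zero_of_meas_eq_zero h0, Measure.coe_zero, Pi.zero_apply]
  exact one_ne_zero ((measure_univ (μ := P)).symm.trans (hPE h1))

/-- A measure absolutely continuous with respect to `μ[|E]` is carried by `E`. [folklore] -/
theorem ae_mem_of_absolutelyContinuous_cond {P μ : Measure Ω} {E : Set Ω} (hE : MeasurableSet E)
    (hPE : P ≪ μ[|E]) : ∀ᵐ x ∂P, x ∈ E :=
  hPE.ae_le (ae_cond_mem hE)

/-! ## The chain rule of log-likelihood ratios along a conditioning -/

/-- **Chain rule along a conditioning.** For a sigma-finite `P ≪ μ[|E]` (with `μ` finite, `μ E ≠ 0`):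
`llr P μ = llr P (μ[|E]) − log μ(E)` `P`-almost everywhere. [folklore] -/
theorem llr_eq_llr_cond_add (P μ : Measure Ω) [SigmaFinite P] [IsFiniteMeasure μ] {E : Set Ω}
    (hE : MeasurableSet E) (hμE : μ E ≠ 0) (hPE : P ≪ μ[|E]) :
    llr P μ =ᵐ[P] fun x => llr P (μ[|E]) x + -Real.log (μ.real E) := by
  -- adapted from `EntropyBall.klDiv_eq_klDiv_cond_add` (…CellForecastPressureDecayKBClosureEntropyTools.lean)
  have hEtop : μ E ≠ ∞ := measure_ne_top μ E
  have hPμ : P ≪ μ := hPE.trans cond_absolutelyContinuous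
  have h2 : P.rnDeriv (μ[|E]) * (μ[|E]).rnDeriv μ =ᵐ[μ] P.rnDeriv μ := Measure.rnDeriv_mul_rnDeriv hPE
  have h3 : ∀ᵐ x ∂P, 0 < P.rnDeriv (μ[|E]) x := Measure.rnDeriv_pos hPE
  have h4 : ∀ᵐ x ∂P, P.rnDeriv (μ[|E]) x < ∞ := hPE.ae_le (Measure.rnDeriv_lt_top P _)
  filter_upwards [hPμ.ae_le (rnDeriv_cond_ae_eq μ hE), hPμ.ae_le h2, h3, h4,
    ae_mem_of_absolutelyContinuous_cond hE hPE] with x hx1 hx2 hx3 hx4 hx5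
  simp only [llr]
  rw [← hx2, Pi.mul_apply, hx1, Set.indicator_of_mem hx5, Pi.one_apply, mul_one, ENNReal.toReal_mul,
    ENNReal.toReal_inv, Real.log_mul (ENNReal.toReal_pos hx3.ne' hx4.ne).ne'
      (inv_ne_zero (ENNReal.toReal_pos hμE hEtop).ne'), Real.log_inv, measureReal_def]

/-- Along a conditioning the two log-likelihood ratios are integrable simultaneously. [folklore] -/
theorem integrable_llr_iff_integrable_llr_cond (P μ : Measure Ω) [IsFiniteMeasure P] [IsFiniteMeasure μ]
    {E : Set Ω} (hE : MeasurableSet E) (hμE : μ E ≠ 0) (hPE : P ≪ μ[|E]) :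
    Integrable (llr P μ) P ↔ Integrable (llr P (μ[|E])) P := by
  rw [integrable_congr (llr_eq_llr_cond_add P μ hE hμE hPE)]
  exact integrable_add_const_iff

/-- Along a conditioning the integrated log-likelihood ratios of a probability measure differ by `−log μ(E)`.
[folklore] -/
theorem integral_llr_eq_integral_llr_cond_sub_log (P μ : Measure Ω) [IsProbabilityMeasure P]
    [IsFiniteMeasure μ] {E : Set Ω} (hE : MeasurableSet E) (hPE : P ≪ μ[|E])
    (hint : Integrable (llr P (μ[|E])) P) :
    ∫ x, llr P μ x ∂P = ∫ x, llr P (μ[|E]) x ∂P - Real.log (μ.real E) := by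
  rw [integral_congr_ae (llr_eq_llr_cond_add P μ hE (measure_ne_zero_of_absolutelyContinuous_cond hPE) hPE),
    integral_add hint (integrable_const _), integral_const, smul_eq_mul, probReal_univ, one_mul]
  ring

/-! ## The relative entropy of the conditioned measure and the additivity -/

/-- **Entropy of the conditioned law**: `klDiv (μ[|E]) μ = ofReal (−log μ(E))` for a probability measure `μ` and
`μ E ≠ 0` (the `ℝ≥0∞` form of `Literature.Probability.Entropy.toReal_klDiv_cond`). [folklore] -/
theorem klDiv_cond_self (μ : Measure Ω) [IsProbabilityMeasure μ] {E : Set Ω} (hE : MeasurableSet E)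
    (hμE : μ E ≠ 0) : klDiv (μ[|E]) μ = ENNReal.ofReal (-Real.log (μ.real E)) := by
  rw [← ENNReal.ofReal_toReal (Literature.Probability.Entropy.klDiv_cond_ne_top μ hE hμE),
    Literature.Probability.Entropy.toReal_klDiv_cond μ hE hμE]

/-- W2-3. **Additivity of the relative entropy along a conditioning.** For probability measures `P`, `μ`, a
measurable event `E` and `P ≪ μ[|E]`: `KL(P ‖ μ) = KL(P ‖ μ[|E]) + KL(μ[|E] ‖ μ)` in `ℝ≥0∞`, the last term
being `−log μ(E)`; both sides are `∞` exactly when `llr P (μ[|E])` is not `P`-integrable. [folklore] -/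
theorem c9_klDiv_eq_klDiv_cond_add_klDiv_cond {Ω : Type*} [MeasurableSpace Ω] (P μ : Measure Ω)
    [IsProbabilityMeasure P] [IsProbabilityMeasure μ] {E : Set Ω} (hE : MeasurableSet E) (hPE : P ≪ μ[|E]) :
    klDiv P μ = klDiv P (μ[|E]) + klDiv (μ[|E]) μ := by
  have hμE : μ E ≠ 0 := measure_ne_zero_of_absolutelyContinuous_cond hPE
  haveI : IsProbabilityMeasure (μ[|E]) := cond_isProbabilityMeasure hμE
  have hPμ : P ≪ μ := hPE.trans cond_absolutelyContinuous
  have hlog : 0 ≤ -Real.log (μ.real E) := by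
    rw [neg_nonneg]
    exact Real.log_nonpos measureReal_nonneg measureReal_le_one
  rw [klDiv_cond_self μ hE hμE]
  by_cases hint : Integrable (llr P (μ[|E])) P
  · have hint' : Integrable (llr P μ) P := (integrable_llr_iff_integrable_llr_cond P μ hE hμE hPE).2 hint
    have hnn : 0 ≤ ∫ x, llr P (μ[|E]) x ∂P := by
      rw [← toReal_klDiv_of_measure_eq hPE (by simp)]
      exact ENNReal.toReal_nonneg
    rw [← ENNReal.ofReal_toReal (klDiv_ne_top hPμ hint'), ← ENNReal.ofReal_toReal (klDiv_ne_top hPE hint),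
      toReal_klDiv_of_measure_eq hPμ (by simp), toReal_klDiv_of_measure_eq hPE (by simp),
      integral_llr_eq_integral_llr_cond_sub_log P μ hE hPE hint, sub_eq_add_neg,
      ENNReal.ofReal_add hnn hlog]
  · have hint' : ¬Integrable (llr P μ) P := fun h =>
      hint ((integrable_llr_iff_integrable_llr_cond P μ hE hμE hPE).1 h)
    rw [klDiv_of_not_integrable hint, klDiv_of_not_integrable hint', top_add]

/-- Along a conditioning the two relative entropies are finite simultaneously. [folklore] -/
theorem klDiv_ne_top_iff_klDiv_cond_ne_top (P μ : Measure Ω) [IsProbabilityMeasure P] [IsProbabilityMeasure μ]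
    {E : Set Ω} (hE : MeasurableSet E) (hPE : P ≪ μ[|E]) : klDiv P μ ≠ ∞ ↔ klDiv P (μ[|E]) ≠ ∞ := by
  rw [c9_klDiv_eq_klDiv_cond_add_klDiv_cond P μ hE hPE,
    klDiv_cond_self μ hE (measure_ne_zero_of_absolutelyContinuous_cond hPE), ENNReal.add_ne_top]
  exact and_iff_left ENNReal.ofReal_ne_top

/-- The real form of the additivity when the entropies are finite:
`(klDiv P μ).toReal = (klDiv P (μ[|E])).toReal − log μ(E)`. [folklore] -/
theorem toReal_klDiv_eq_toReal_klDiv_cond_sub_log (P μ : Measure Ω) [IsProbabilityMeasure P]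
    [IsProbabilityMeasure μ] {E : Set Ω} (hE : MeasurableSet E) (hPE : P ≪ μ[|E])
    (hfin : klDiv P (μ[|E]) ≠ ∞) : (klDiv P μ).toReal = (klDiv P (μ[|E])).toReal - Real.log (μ.real E) := by
  have hlog : 0 ≤ -Real.log (μ.real E) := by
    rw [neg_nonneg]
    exact Real.log_nonpos measureReal_nonneg measureReal_le_one
  rw [c9_klDiv_eq_klDiv_cond_add_klDiv_cond P μ hE hPE,
    klDiv_cond_self μ hE (measure_ne_zero_of_absolutelyContinuous_cond hPE),
    ENNReal.toReal_add hfin ENNReal.ofReal_ne_top, ENNReal.toReal_ofReal hlog]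
  ring

end Summit.AtomisticToContinuum.HydrodynamicLimit.Theorems.KiferCompactification

end
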